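import Summits.AtomisticToContinuum.BoseEinsteinCondensation.Theorems.BECStronglyRayleighLatticeToPeriodicBridgeMuffinTinDeepWellReadout
import HarnessLib

/-!
# Route `BECStronglyRayleigh`, crux `LatticeToPeriodicBridge` (stmt-AtomisticToContinuum-9674),
# line `muffin-tin-reward-supermodularity` — S2' decomposition, file 5/5: (P1) ∧ (P2) ⇒ `Sig.stub_deepWellCondensateLimit`

Last file of the worker decomposition of the registered open stub `Sig.stub_deepWellCondensateLimit`
(see `…MuffinTinDeepWellProfiles.lean` for the profiles and the debts (P1) `FreeDeepBandLimit`,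
(P2) `HardCoreDeepWellLimit`, and `…MuffinTinDeepWellReadout.lean` for the proved readout (P3) `profileReadout`).

* `DeepWellGlue.cohSum_le_card_mul` — `cohSum ψ N ≤ M³ N` for a normalised vector of the `N`-sector
  (`n_{k=0} ≤ N` for hard-core bosons: Cauchy–Schwarz in each insertion sum and the double count
  `Σ_T Σ_{x∉T} |ψ(1_{T∪{x}})|² = N`), needed in the free corner `v = 0` a.e.;
* `DeepWellGlue.ofReal_sub_le_condensateOccupation` — the `L²`-transfer step: a normalised continuous `Ψ` that is
  `(ε/2N)²`-close in `L²(Λ^N)` to a phase times a continuous profile `Φ` of norm `≤ 1` with `n₀(Φ) = ofReal a` has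
  `n₀(Ψ) ≥ ofReal (a - ε)` (LSSY App. A (A.11)/(A.13): `condensateOccupation_le_add_lintegral_rpow`);
* `deepWellCondensateLimit_of_limits : FreeDeepBandLimit → HardCoreDeepWellLimit → Sig.stub_deepWellCondensateLimit`
  (registered sub-goal): case split on `∀ᵐ r, 0 < r → v r = 0`; free case (P1) + `n₀(freeProfile) = z_w N` +
  `z_w N ≥ z_w cohSum/M³`; interacting case (P2) + `n₀(hardCoreProfile ψ) = z_w cohSum/M³`.

So the residual analytic debt of S2' is exactly (P1) ∧ (P2): (P1) is in print (monotone convergence of closed forms,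
Kato VIII §3 / Simon 1978; Kronig–Penney, Reed–Simon IV §XIII.16) but not in Mathlib; (P2) is not in print for `N`
bosons in `M³` wells (two wells: Rougerie–Spehner 2018; one body: Helffer–Sjöstrand 1984).
-/

noncomputable section

namespace Summit.AtomisticToContinuum.BoseEinsteinCondensation.Cruxes.LatticeToPeriodicBridge.MuffinTinRewardSupermodularity

open MeasureTheory Filter Set
open scoped ENNReal NNReal BigOperators Topology ComplexConjugate
open Literature.MathematicalPhysics.QuantumManyBody.BoseGas
open Literature.MathematicalPhysics.QuantumLattice
open Literature.Probability.LatticeModels (TorusSite)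
open Summit.AtomisticToContinuum.BoseEinsteinCondensation.Theses
open Summit.AtomisticToContinuum.BoseEinsteinCondensation.Theses.BECStronglyRayleigh
open Summit.AtomisticToContinuum.BoseEinsteinCondensation.Theorems

open DeepWell

/-! ## Glue lemmas -/

namespace DeepWellGlue

variable {N : ℕ} {L : ℝ}

/-- Multiplying by a phase does not change `∫⁻ ‖·‖²` on the cell. [folklore] -/
theorem lintegral_phase_mul_sq (θ : ℝ) (Φ : Config N → ℂ) :
    ∫⁻ X in cellN N L, (‖Complex.exp (θ * Complex.I) * Φ X‖₊ : ℝ≥0∞) ^ 2 =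
      ∫⁻ X in cellN N L, (‖Φ X‖₊ : ℝ≥0∞) ^ 2 := by
  refine lintegral_congr fun X => ?_
  rw [coe_nnnorm_mul_sq, coe_nnnorm_exp_mul_I_sq, one_mul]

/-- `∫⁻ ‖Φ - Ψ‖² = ∫⁻ ‖Ψ - Φ‖²`. [folklore] -/
theorem lintegral_sub_sq_comm (Φ Ψ : Config N → ℂ) :
    ∫⁻ X in cellN N L, (‖Φ X - Ψ X‖₊ : ℝ≥0∞) ^ 2 = ∫⁻ X in cellN N L, (‖Ψ X - Φ X‖₊ : ℝ≥0∞) ^ 2 := by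
  refine lintegral_congr fun X => ?_
  rw [← nnnorm_neg, neg_sub]

/-- With `η = (ε/(2N))²`, `2N · (ofReal η)^{1/2} = ofReal ε`. [folklore] -/
theorem two_mul_card_mul_rpow_half (hN : 1 ≤ N) {ε : ℝ} (hε : 0 ≤ ε) :
    (2 : ℝ≥0∞) * N * (ENNReal.ofReal ((ε / (2 * N)) ^ 2)) ^ (1 / 2 : ℝ) = ENNReal.ofReal ε := by
  have hN' : (0 : ℝ) < N := by exact_mod_cast hN
  rw [ofReal_rpow_half_eq_sqrt (sq_nonneg _), Real.sqrt_sq (by positivity), two_mul_natCast_mul_ofReal]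
  congr 1
  field_simp

/-- `ofReal a ≤ n + ofReal ε ⇒ ofReal (a - ε) ≤ n` (`ε ≥ 0`). [folklore] -/
theorem ofReal_sub_le_of_le_add {a ε : ℝ} {n : ℝ≥0∞} (hε : 0 ≤ ε)
    (h : ENNReal.ofReal a ≤ n + ENNReal.ofReal ε) : ENNReal.ofReal (a - ε) ≤ n := by
  rw [ENNReal.ofReal_sub a hε]
  exact tsub_le_iff_right.mpr h

/-- **Transfer step.** If a normalised continuous `Ψ` is `η`-close in `L²(Λ^N)` to `e^{iθ}Φ` with `Φ`
continuous of norm `≤ 1` and `n₀(Φ) = ofReal a`, and `η = (ε/(2N))²`, then `ofReal (a - ε) ≤ n₀(Ψ)`.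
[folklore] -/
theorem ofReal_sub_le_condensateOccupation (hL : 0 < L) (hN : 1 ≤ N) {Φ Ψ : Config N → ℂ}
    (hΦ : Continuous Φ) (hΨ : Continuous Ψ)
    (hΦ1 : ∫⁻ X in cellN N L, (‖Φ X‖₊ : ℝ≥0∞) ^ 2 ≤ 1)
    (hΨ1 : ∫⁻ X in cellN N L, (‖Ψ X‖₊ : ℝ≥0∞) ^ 2 ≤ 1) {a ε : ℝ} (hε : 0 ≤ ε)
    (ha : condensateOccupation N L Φ = ENNReal.ofReal a) {θ : ℝ}
    (hclose : ∫⁻ X in cellN N L, (‖Ψ X - Complex.exp (θ * Complex.I) * Φ X‖₊ : ℝ≥0∞) ^ 2 ≤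
      ENNReal.ofReal ((ε / (2 * N)) ^ 2)) :
    ENNReal.ofReal (a - ε) ≤ condensateOccupation N L Ψ := by
  set Φ' : Config N → ℂ := fun X => Complex.exp (θ * Complex.I) * Φ X with hΦ'
  have hΦ'c : Continuous Φ' := continuous_const.mul hΦ
  have hΦ'1 : ∫⁻ X in cellN N L, (‖Φ' X‖₊ : ℝ≥0∞) ^ 2 ≤ 1 := by
    rw [hΦ', lintegral_phase_mul_sq]; exact hΦ1
  have hn : condensateOccupation N L Φ' = ENNReal.ofReal a := by
    rw [hΦ', condensateOccupation_phase_mul, ha]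
  have hlip := condensateOccupation_le_add_lintegral_rpow hL hΦ'c hΨ hΦ'1 hΨ1
  rw [hn, lintegral_sub_sq_comm] at hlip
  refine ofReal_sub_le_of_le_add hε (hlip.trans ?_)
  rw [← two_mul_card_mul_rpow_half hN hε]
  gcongr

/-- **`cohSum ψ N ≤ M³ N`** for a normalised vector of the sector of `N` up spins (`n_{k=0} ≤ N` for
hard-core bosons): Cauchy–Schwarz in each insertion sum (`|Λ ∖ T| ≤ M³` terms), then the double count
`Σ_T Σ_{x ∉ T} |ψ(1_{T ∪ {x}})|² = Σ_S |S| |ψ(1_S)|² = N Σ_S |ψ(1_S)|² = N` (amplitudes live on `N`-sets).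
[folklore] -/
theorem cohSum_le_card_mul {M : ℕ} [NeZero M] (N : ℕ) (ψ : TensorIndex (TorusSite 3 M) 2 → ℂ)
    (hsec : ψ ∈ spinZSector 1 ((N : ℝ) - (M : ℝ) ^ 3 / 2)) (hnorm : ∑ σ, ‖ψ σ‖ ^ 2 = 1) :
    cohSum ψ N ≤ (M : ℝ) ^ 3 * N := by
  classical
  have hcard := InsertionFieldDelocalisation.Negative.card_torusSite 3 M
  have hsupp : ∀ S : Finset (TorusSite 3 M), S.card ≠ N → ψ (occInd S) = 0 := fun S hS =>
    LatticeCoherence.apply_ind_eq_zero_of_card_ne N (by rw [hcard]; push_cast; ring) hsec S hS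
  set g : Finset (TorusSite 3 M) → ℝ := fun S => ‖ψ (occInd S)‖ ^ 2 with hg
  have hg0 : ∀ S, 0 ≤ g S := fun S => by positivity
  -- Step 1: Cauchy–Schwarz in each insertion sum, and extend the sum to all `T`
  have h1 : cohSum ψ N ≤ (M : ℝ) ^ 3 *
      ∑ T : Finset (TorusSite 3 M), ∑ x, (if x ∉ T then g (insert x T) else 0) := by
    unfold cohSum
    rw [Finset.mul_sum]
    calc ∑ T ∈ (Finset.univ : Finset (TorusSite 3 M)).powersetCard (N - 1),
          ‖∑ x ∈ Finset.univ \ T, ψ (occInd (insert x T))‖ ^ 2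
        ≤ ∑ T ∈ (Finset.univ : Finset (TorusSite 3 M)).powersetCard (N - 1),
            (M : ℝ) ^ 3 * ∑ x, (if x ∉ T then g (insert x T) else 0) := by
          refine Finset.sum_le_sum fun T _ => ?_
          have hfilt : ∑ x, (if x ∉ T then g (insert x T) else 0) =
              ∑ x ∈ Finset.univ \ T, g (insert x T) := by
            rw [Finset.sdiff_eq_filter, Finset.sum_filter]
          rw [hfilt]
          calc ‖∑ x ∈ Finset.univ \ T, ψ (occInd (insert x T))‖ ^ 2
              ≤ (∑ x ∈ Finset.univ \ T, ‖ψ (occInd (insert x T))‖) ^ 2 := by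
                gcongr
                exact norm_sum_le _ _
            _ ≤ (Finset.univ \ T).card * ∑ x ∈ Finset.univ \ T, ‖ψ (occInd (insert x T))‖ ^ 2 :=
                sq_sum_le_card_mul_sum_sq
            _ ≤ (M : ℝ) ^ 3 * ∑ x ∈ Finset.univ \ T, g (insert x T) := by
                have hc : ((Finset.univ \ T).card : ℝ) ≤ (M : ℝ) ^ 3 := by
                  have := Finset.card_le_univ (Finset.univ \ T)
                  rw [hcard] at this
                  exact_mod_cast this
                exact mul_le_mul_of_nonneg_right hc (Finset.sum_nonneg fun x _ => hg0 _)
      _ ≤ ∑ T, (M : ℝ) ^ 3 * ∑ x, (if x ∉ T then g (insert x T) else 0) :=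
          Finset.sum_le_sum_of_subset_of_nonneg (Finset.subset_univ _) fun T _ _ =>
            mul_nonneg (by positivity) (Finset.sum_nonneg fun x _ => by split_ifs <;> simp [hg0])
  -- Step 2: double counting `(T, x ∉ T) ↔ (S = T ∪ {x}, x ∈ S)`
  have h2 : ∑ T : Finset (TorusSite 3 M), ∑ x, (if x ∉ T then g (insert x T) else 0) =
      ∑ S : Finset (TorusSite 3 M), (S.card : ℝ) * g S := by
    rw [Finset.sum_comm]
    have hx : ∀ x : TorusSite 3 M, ∑ T : Finset (TorusSite 3 M), (if x ∉ T then g (insert x T) else 0) =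
        ∑ S : Finset (TorusSite 3 M), (if x ∈ S then g S else 0) := by
      intro x
      have := LatticeCoherence.sum_insert_mul_self_eq (fun S => ‖ψ (occInd S)‖) x
      simp only [and_self, ← sq] at this
      exact this
    rw [Finset.sum_congr rfl fun x _ => hx x, Finset.sum_comm]
    refine Finset.sum_congr rfl fun S _ => ?_
    rw [Finset.sum_ite_mem, Finset.univ_inter, Finset.sum_const, nsmul_eq_mul]
  -- Step 3: amplitudes live on `N`-sets, and `Σ_S |ψ(1_S)|² = Σ_σ |ψ σ|² = 1`
  have h3 : ∑ S : Finset (TorusSite 3 M), (S.card : ℝ) * g S = N * ∑ S : Finset (TorusSite 3 M), g S := by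
    rw [Finset.mul_sum]
    refine Finset.sum_congr rfl fun S _ => ?_
    by_cases hS : S.card = N
    · rw [hS]
    · simp [hg, hsupp S hS]
  have h4 : ∑ S : Finset (TorusSite 3 M), g S = 1 := by
    rw [← hnorm, LatticeCoherence.sum_config_eq_sum_finset (fun σ => ‖ψ σ‖ ^ 2)]
    rfl
  calc cohSum ψ N ≤ (M : ℝ) ^ 3 * ∑ T : Finset (TorusSite 3 M), ∑ x, (if x ∉ T then g (insert x T) else 0) := h1
    _ = (M : ℝ) ^ 3 * N := by rw [h2, h3, h4, mul_one]

end DeepWellGlue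

open DeepWellGlue

/-! ## The registered sub-goal: (P1) ∧ (P2) ⇒ S2' -/

/-- **Registered sub-goal `deepWellCondensateLimit_of_limits` — Glue: (P1) ∧ (P2) ⇒ S2'**
(`Sig.stub_deepWellCondensateLimit`, by name; (P3) is the theorem `profileReadout`). Case `v = 0` a.e.: (P1) + readout + Lipschitz give `n₀ ≥ z_w N - ε ≥ z_w cohSum/M³ - ε`
(`cohSum_le_card_mul`); otherwise (P2) + readout + Lipschitz give `n₀ ≥ z_w cohSum/M³ - ε`. [folklore] -/
theorem deepWellCondensateLimit_of_limits (h1 : FreeDeepBandLimit) (h2 : HardCoreDeepWellLimit) : Sig.stub_deepWellCondensateLimit := by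
  have h3 : ProfileReadout := profileReadout
  intro v R₀ hmeas hR₀ hvR w hw0 hw1 M _ hM L hL hwall hwell N hN1 hN2 ψ hψ ε hε
  have hMpos : (0 : ℝ) < M := by exact_mod_cast (lt_of_lt_of_le (by norm_num) hM : 0 < M)
  have hz : 0 ≤ deepShare w := by
    unfold deepShare
    have : 0 ≤ 8 / Real.pi ^ 2 * (1 - w) := by
      have h1w : 0 ≤ 1 - w := by linarith
      positivity
    positivity
  obtain ⟨hsec, heig, hnorm⟩ := hψ
  obtain ⟨⟨hfree1, hfreen⟩, hhc⟩ := h3 M L w hL hw0 hw1 N hN1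
  have hη : 0 < (ε / (2 * N)) ^ 2 := by
    have hN' : (0 : ℝ) < N := by exact_mod_cast hN1
    positivity
  by_cases hv : ∀ᵐ r : ℝ, 0 < r → v r = 0
  · -- Case A: `v = 0` a.e. — free bosons, limit occupation `z_w N ≥ z_w cohSum/M³`
    have key := h1 v hmeas hv w hw0 hw1 M L hL N hN1 _ hη
    filter_upwards [key] with lam hlam
    intro δ hδ
    obtain ⟨Ψ, hΨF, θ, hθ⟩ := hlam δ hδ
    refine ⟨Ψ, hΨF, ?_⟩
    have hstep := ofReal_sub_le_condensateOccupation hL hN1 continuous_freeProfile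
      Ψ.contDiff.continuous hfree1.le Ψ.norm_eq.le hε.le hfreen hθ
    refine le_trans (ENNReal.ofReal_le_ofReal ?_) hstep
    have hc := cohSum_le_card_mul N ψ hsec hnorm
    have hM3 : (0 : ℝ) < (M : ℝ) ^ 3 := by positivity
    have : deepShare w / (M : ℝ) ^ 3 * cohSum ψ N ≤ deepShare w * N := by
      rw [div_mul_eq_mul_div, div_le_iff₀ hM3]
      calc deepShare w * cohSum ψ N ≤ deepShare w * ((M : ℝ) ^ 3 * N) :=
            mul_le_mul_of_nonneg_left hc hz
        _ = deepShare w * N * (M : ℝ) ^ 3 := by ring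
    linarith
  · -- Case B: `v ≠ 0` on positive measure — hard-core well occupations dressed by `ψ`
    obtain ⟨hhc1, hhcn⟩ := hhc ψ hsec hnorm
    have key := h2 v R₀ hmeas hR₀ hvR hv w hw0 hw1 M hM L hL hwall hwell N hN1 hN2 ψ
      ⟨hsec, heig, hnorm⟩ _ hη
    filter_upwards [key] with lam hlam
    intro δ hδ
    obtain ⟨Ψ, hΨF, θ, hθ⟩ := hlam δ hδ
    exact ⟨Ψ, hΨF, ofReal_sub_le_condensateOccupation hL hN1 continuous_hardCoreProfile
      Ψ.contDiff.continuous hhc1.le Ψ.norm_eq.le hε.le hhcn hθ⟩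

/-- The same glue under its census name. [folklore] -/
theorem deepWellCondensateLimit_of (h1 : FreeDeepBandLimit) (h2 : HardCoreDeepWellLimit) :
    Sig.stub_deepWellCondensateLimit :=
  deepWellCondensateLimit_of_limits h1 h2

end Summit.AtomisticToContinuum.BoseEinsteinCondensation.Cruxes.LatticeToPeriodicBridge.MuffinTinRewardSupermodularity

end
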